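import Summits.MatrixMultiplication.MatrixMultiplication.Theses.AlgebraicSTPPDichotomy

/-!
# Disproof work file for crux `SubcubicFrameFamily` (stmt-MatrixMultiplication-7623)

Standing adversary file (refuter, cdisprove mode).  Crux (route AlgebraicSTPPDichotomy, rank 4):
`∃ m τ, 2 ≤ τ < 3 ∧ ∀ q₀ ∃ F (|F| ≥ q₀) ∃ STPP family of punctured-subspace frames in F^m with
|F|^m ≤ Σ_i (|A_i||B_i||C_i|)^{τ/3}` — a bounded-RANK abelian STPP certificate strictly below 3 at
power level.

## Findings (every `theorem` below is sorry-free, axioms ⊆ {propext, Classical.choice, Quot.sound})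

* `subcubicFrameFamily_iff` — the crux is literally `∃ m τ, 2 ≤ τ < 3 ∧ ∀ q₀ ∃ F, FrameWitness m τ F`.
* LOAD-BEARING ANALYSIS (the crux is existential, so "constraint dropped ⇒ statement TRUE cheaply"
  is the informative direction: any DISproof must use that constraint, any proof must beat it):
  - `subcubicFrameFamilyTauLe_holds` : with `τ ≤ 3` in place of `τ < 3` the statement is TRUE
    (m = 3, τ = 3, CKSU 2005 §5 coordinate design over `ZMod p`, `p ≥ 5`: `p^3 ≤ 2(p-1)^3`;
    `cksu_isSTPP` verifies the design over EVERY field).  The content of the crux is `τ < 3`.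
  - `subcubicFrameFamilySwapped_holds` : with the quantifiers swapped (`∀ q₀ ∃ τ < 3`) it is TRUE
    (same design, `τ_p ↑ 3` by continuity).  The content is UNIFORMITY of `τ` as `|F| → ∞`.
  - `subcubicFrameFamilyDropTwoLe_holds` : without `2 ≤ τ` it is TRUE BY JUNK (`τ = 0`, `m = 0`,
    one empty block: `(0:ℝ)^0 = 1 ≥ |F|^0`).  `2 ≤ τ` guards exactly this; for `0 < τ < 2` the
    statement is equivalent to `τ = 2` by monotonicity (not formalised).
* NECESSARY CONDITIONS ON A WITNESS / REFUTED STRENGTHENINGS (prover briefing):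
  - `card_block_le` : abelian TPP injectivity, `|A_i||B_i||C_i| ≤ |F|^m` per block;
  - `card_rpow_le_fullCount` : hence `#full blocks ≥ |F|^{m(1-τ/3)} → ∞`;
  - `not_subcubicFrameFamilyBoundedBlocks` : ¬ S1 (N bounded) — all e = 0 designs are out;
  - `direct_of_full`, `three_le_rank_of_full`, `not_frameWitnessN_rank_le_two` : TPP forces the
    frame `V ⊕ W ⊕ U` to be direct (|F| ≥ 3), so m ≥ 3;
  - `complementary_atMostTwo` (PROVED, |F| ≥ 5): the full blocks with `V ⊔ W ⊔ U = ⊤` number ≤ 2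
    (two such blocks are cyclic rotations `(V,W,U) ↦ (W,U,V)` of each other — pointwise engine:
    a space over F is not a union of 4 proper subspaces, Mathlib
    `Submodule.iUnion_ssubset_of_forall_ne_top_of_card_lt` — and a rotation chain x → y → z
    violates the all-distinct clause);
  - `rankThreeNoGo_holds : RankThreeNoGo` — the route's support item 7625 FOLLOWS (in F^3 every
    full block is complementary); hence `not_subcubicFrameFamilyRankLe3` : ¬ S2 UNCONDITIONALLY —
    ANY WITNESS HAS RANK m ≥ 4;
  - `not_subcubicFrameFamilyComplementary` : ¬ S3 — complementary frames (v = m; the numerologies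
    (4,(2,1,1)), (5,(2,2,1)), (6,(2,2,2)), … with e ≥ 1) never witness the crux;
  - `card_block_le_pow_finrank`, `sum_rpow_le_bookkeeping` : DIMENSION BOOKKEEPING —
    `|A_i||B_i||C_i| ≤ |F|^{dim(V_i ⊔ W_i ⊔ U_i)}` and, for |F| ≥ 5,
    `Σ ≤ 2·|F|^{mτ/3} + N'·|F|^{(m−1)τ/3}` with N' = #(full non-complementary blocks): a witness
    needs N' ≳ |F|^{m−(m−1)τ/3} blocks on frames with v ≤ m − 1 (m = 4: N' ≫ |F| line blocks;
    census says 3), and in general N_v ≥ |F|^{m − vτ/3} for some v ≤ m−1, i.e. must beat |F|^{m−v}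
    by the power |F|^{v(1−τ/3)} (packing allows |F|^{m−2v/3}).
* COMPUTATION 1 (`census/lines_census.py`; kit jobs j005119 q=7,11 and j005120 q=13 queued, evidence
  lands on the item): exact maximum number of blocks of an STPP punctured-LINE family in F_q^4 is
  3 for q = 3, 5 (local, 1 s / 62 s; projective reformulation cross-checked against the raw
  `IsSTPP`); the (4,1) numerology would need N(q) ≫ q^{4−τ} > q; the compatible-pair orbit count
  under Stab(block₀) is 94 (q=3), 79 (q=5) — q-stable — and in every branch the common
  neighbourhood of a compatible pair has NO compatible pair inside (a 4th block never exists).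
* COMPUTATION 2 (`census/torus6.py`, the route's "first candidate home" m = 6 over the norm-one
  torus T = ker(N : F_{q^6}^× → F_{q^2}^×), |T| = q^4+q^2+1 = packing-exact): ORBIT families
  {(t, t b, t c) : t ∈ T}.  T ∩ F_q^× = {λ : λ^3 = 1}, so q ≡ 1 (mod 3) is excluded outright (T does
  not act freely on points).  q = 3: the P-pairing is T-packed for 546/726 b, 221448 base blocks
  have all three pairings T-packed, NONE of 400 tested Frobenius representatives satisfies even
  the STPP pair conditions for the whole orbit (≤ 88/90 good t), and the largest STPP SUB-family
  of an orbit family is 8 < q^2.  q = 5: 4632/15620 packed b, 6.39·10^6 triple-packed base blocks,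
  NONE of 300 tested representatives passes the pair conditions (568–606 of 650 good t).  So the
  naive torus-orbit design is not STPP at q = 3, 5; "packs one pairing perfectly" does not extend
  to the cross conditions.
* WHY IT RESISTS: after the above, the first open numerologies are lines in F^4 (needs N ≫ q,
  census says 3) and everything from m = 5 on; the negation is a FrameBarrier-type uniform power
  saving for every m, for which no slicing/packing argument gives a power of q at bounded rank
  (Thm B saves 0.84^m only), while random/greedy constructions stay far below N_v ≥ q^{m−v+3−τ}.
-/

set_option linter.dupNamespace false

namespace Summit.MatrixMultiplication.MatrixMultiplication.Cruxes.SubcubicFrameFamily.Disproof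

open Finset Filter Topology
open Literature.Computability.AlgebraicComplexity (IsSTPP)
open Summit.MatrixMultiplication.MatrixMultiplication.Theses.AlgebraicSTPPDichotomy

def FrameWitnessN (m : ℕ) (τ : ℝ) (F : Type) [Field F] [Fintype F] (N : ℕ) : Prop :=
  ∃ (V W U : Fin N → Submodule F (Fin m → F)) (A B C : Fin N → Finset (Fin m → F)),
    (∀ i v, v ∈ A i ↔ v ∈ V i ∧ v ≠ 0) ∧ (∀ i v, v ∈ B i ↔ v ∈ W i ∧ v ≠ 0) ∧
    (∀ i v, v ∈ C i ↔ v ∈ U i ∧ v ≠ 0) ∧ IsSTPP A B C ∧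
    (Fintype.card F : ℝ) ^ m ≤ ∑ i, (((A i).card * (B i).card * (C i).card : ℕ) : ℝ) ^ (τ / 3)

def FrameWitness (m : ℕ) (τ : ℝ) (F : Type) [Field F] [Fintype F] : Prop :=
  ∃ N : ℕ, FrameWitnessN m τ F N

section Counting

variable {H : Type*} [AddCommGroup H] [Fintype H] {N : ℕ} {A B C : Fin N → Finset H}

/-- **Abelian TPP injectivity.** In an STPP family (clause `i = j = k`), `(a,b,c) ↦ a + b + c` is
injective on `A i × B i × C i`, so `|A i| |B i| |C i| ≤ |H|`: one block never beats the trivial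
bound in an abelian group. [folklore; CKSU 2003 Lemma 3.1 for abelian groups] -/
theorem card_block_le (h : IsSTPP A B C) (i : Fin N) :
    (A i).card * (B i).card * (C i).card ≤ Fintype.card H := by
  classical
  have hinj : Set.InjOn (fun p : H × H × H => p.1 + p.2.1 + p.2.2) ↑(A i ×ˢ (B i ×ˢ C i)) := by
    rintro ⟨a, b, c⟩ habc ⟨a', b', c'⟩ habc' heq
    simp only [Finset.coe_product, Set.mem_prod, Finset.mem_coe] at habc habc'
    obtain ⟨ha, hb, hc⟩ := habc
    obtain ⟨ha', hb', hc'⟩ := habc'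
    have heq' : a + b + c = a' + b' + c' := heq
    have key : (a - a') + (b - b') + (c - c') = 0 := by
      have : (a - a') + (b - b') + (c - c') = (a + b + c) - (a' + b' + c') := by abel
      rw [this, heq', sub_self]
    obtain ⟨-, -, h1, h2, h3⟩ := h i i i a' ha' a ha b' hb' b hb c' hc' c hc key
    rw [h1, h2, h3]
  have hmaps : Set.MapsTo (fun p : H × H × H => p.1 + p.2.1 + p.2.2) ↑(A i ×ˢ (B i ×ˢ C i))
      ↑(Finset.univ : Finset H) := fun p _ => Finset.mem_coe.2 (Finset.mem_univ _)
  have := Finset.card_le_card_of_injOn _ hmaps hinj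
  simpa [Finset.card_product, mul_assoc] using this

/-- The number of FULL blocks (all three sets non-empty), as in `RankThreeNoGo`. -/
def fullCount (A B C : Fin N → Finset H) : ℕ :=
  (Finset.univ.filter fun i => (A i).Nonempty ∧ (B i).Nonempty ∧ (C i).Nonempty).card

omit [AddCommGroup H] [Fintype H] in
theorem fullCount_le (A B C : Fin N → Finset H) : fullCount A B C ≤ N := by
  unfold fullCount
  exact (Finset.card_filter_le _ _).trans (by simp)

/-- **The power sum is carried by full blocks, each at most `|H|^e`.** For `e > 0`,
`Σ_i (|A i||B i||C i|)^e ≤ #full · |H|^e`. -/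
theorem sum_rpow_le_fullCount_mul (h : IsSTPP A B C) {e : ℝ} (he : 0 < e) :
    ∑ i, (((A i).card * (B i).card * (C i).card : ℕ) : ℝ) ^ e ≤
      fullCount A B C * (Fintype.card H : ℝ) ^ e := by
  classical
  have hterm : ∀ i, (((A i).card * (B i).card * (C i).card : ℕ) : ℝ) ^ e ≤
      if (A i).Nonempty ∧ (B i).Nonempty ∧ (C i).Nonempty then (Fintype.card H : ℝ) ^ e else 0 := by
    intro i
    split_ifs with hfull
    · exact Real.rpow_le_rpow (Nat.cast_nonneg _) (by exact_mod_cast card_block_le h i) he.le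
    · have h0 : (A i).card * (B i).card * (C i).card = 0 := by
        simp only [not_and_or, Finset.not_nonempty_iff_eq_empty] at hfull
        rcases hfull with h | h | h <;> simp [h]
      rw [h0, Nat.cast_zero, Real.zero_rpow he.ne']
  refine (Finset.sum_le_sum fun i _ => hterm i).trans ?_
  rw [Finset.sum_ite, Finset.sum_const_zero, add_zero, Finset.sum_const, nsmul_eq_mul]
  rfl

end Counting

/-- **A witness needs `|F|^{m(1-τ/3)}` full blocks.** If an STPP family in `F^m` has power sum at
exponent `τ/3 > 0` at least `|F|^m`, then `#full ≥ |F|^{m(1 − τ/3)}`; for `τ < 3` this tends to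
infinity with `|F|`, so bounded-size designs (all `e = 0` designs, in the route's bookkeeping)
cannot witness the crux. -/
theorem card_rpow_le_fullCount {m : ℕ} {τ : ℝ} (hτ : 0 < τ) {F : Type} [Field F] [Fintype F]
    {N : ℕ} {A B C : Fin N → Finset (Fin m → F)} (hS : IsSTPP A B C)
    (hsum : (Fintype.card F : ℝ) ^ m ≤
      ∑ i, (((A i).card * (B i).card * (C i).card : ℕ) : ℝ) ^ (τ / 3)) :
    (Fintype.card F : ℝ) ^ ((m : ℝ) * (1 - τ / 3)) ≤ fullCount A B C := by
  have hq : (0 : ℝ) < Fintype.card F := Nat.cast_pos.2 Fintype.card_pos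
  have hH : (Fintype.card (Fin m → F) : ℝ) = (Fintype.card F : ℝ) ^ (m : ℝ) := by
    rw [Fintype.card_fun, Fintype.card_fin, Nat.cast_pow, Real.rpow_natCast]
  have h1 := sum_rpow_le_fullCount_mul hS (e := τ / 3) (by positivity)
  rw [hH, ← Real.rpow_mul hq.le] at h1
  have h2 : (Fintype.card F : ℝ) ^ (m : ℝ) ≤ fullCount A B C * (Fintype.card F : ℝ) ^ ((m : ℝ) * (τ / 3)) := by
    rw [Real.rpow_natCast]; exact hsum.trans h1
  have h3 : (m : ℝ) * (1 - τ / 3) = (m : ℝ) - (m : ℝ) * (τ / 3) := by ring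
  rw [h3, Real.rpow_sub hq, div_le_iff₀ (Real.rpow_pos_of_pos hq _)]
  exact h2

/-- STRENGTHENING S1 (bounded number of blocks): the crux with the extra demand that the number of
blocks stay bounded as `|F| → ∞`. -/
def SubcubicFrameFamilyBoundedBlocks : Prop :=
  ∃ (m : ℕ) (τ : ℝ) (N₀ : ℕ), 2 ≤ τ ∧ τ < 3 ∧ ∀ q₀ : ℕ, ∃ (F : Type) (_ : Field F) (_ : Fintype F),
    q₀ ≤ Fintype.card F ∧ ∃ N, N ≤ N₀ ∧ FrameWitnessN m τ F N

/-- In rank `0` there is no witness at any exponent `τ ≠ 0`: every frame is empty. -/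
theorem not_frameWitnessN_rank_zero {τ : ℝ} (hτ : τ ≠ 0) {F : Type} [Field F] [Fintype F] {N : ℕ} :
    ¬ FrameWitnessN 0 τ F N := by
  rintro ⟨V, W, U, A, B, C, hA, -, -, -, hsum⟩
  have hAe : ∀ i, A i = ∅ := by
    intro i
    ext v
    simp only [Finset.notMem_empty, iff_false]
    intro hv
    exact ((hA i v).1 hv).2 (Subsingleton.elim _ _)
  have h0 : ∑ i, (((A i).card * (B i).card * (C i).card : ℕ) : ℝ) ^ (τ / 3) = 0 := by
    refine Finset.sum_eq_zero fun i _ => ?_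
    rw [hAe i, Finset.card_empty, zero_mul, zero_mul, Nat.cast_zero,
      Real.zero_rpow (by positivity)]
  rw [h0, pow_zero] at hsum
  exact absurd hsum (by norm_num)

/-- **¬ S1: no witness with boundedly many blocks** (any proof of the crux needs `N → ∞`, indeed
`N ≥ |F|^{m(3-τ)/3}`). -/
theorem not_subcubicFrameFamilyBoundedBlocks : ¬ SubcubicFrameFamilyBoundedBlocks := by
  rintro ⟨m, τ, N₀, h2, h3, h⟩
  rcases Nat.eq_zero_or_pos m with hm | hm
  · subst hm
    obtain ⟨F, _, _, -, N, -, hW⟩ := h 0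
    exact not_frameWitnessN_rank_zero (by linarith) hW
  have he : 0 < (m : ℝ) * (1 - τ / 3) := mul_pos (by exact_mod_cast hm) (by linarith)
  have htend : Tendsto (fun q : ℕ => (q : ℝ) ^ ((m : ℝ) * (1 - τ / 3))) atTop atTop :=
    (tendsto_rpow_atTop he).comp tendsto_natCast_atTop_atTop
  obtain ⟨q₀, hq₀⟩ := Filter.eventually_atTop.1 (htend.eventually_gt_atTop (N₀ : ℝ))
  obtain ⟨F, _, _, hF, N, hN, V, W, U, A, B, C, hA, hB, hC, hS, hsum⟩ := h q₀
  have h1 := card_rpow_le_fullCount (by linarith) hS hsum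
  have h4 : (fullCount A B C : ℝ) ≤ N₀ := by exact_mod_cast (fullCount_le A B C).trans hN
  have h5 : (N₀ : ℝ) < (q₀ : ℝ) ^ ((m : ℝ) * (1 - τ / 3)) := hq₀ q₀ le_rfl
  have h6 : (q₀ : ℝ) ^ ((m : ℝ) * (1 - τ / 3)) ≤ (Fintype.card F : ℝ) ^ ((m : ℝ) * (1 - τ / 3)) :=
    Real.rpow_le_rpow (Nat.cast_nonneg _) (by exact_mod_cast hF) he.le
  linarith


/-! ## The CKSU 2005 §5 coordinate design in `F^3` (tightness at τ = 3) -/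
section CKSU


variable (F : Type) [Field F]

/-- The coordinate line `F · e_c` in `F^3`, as the submodule of vectors vanishing off `c`. -/
def coordLine (c : Fin 3) : Submodule F (Fin 3 → F) where
  carrier := {v | ∀ l, l ≠ c → v l = 0}
  add_mem' := by
    intro a b ha hb l hl
    simp [ha l hl, hb l hl]
  zero_mem' := by intro l _; rfl
  smul_mem' := by
    intro r a ha l hl
    simp [ha l hl]

variable {F}

theorem mem_coordLine {c : Fin 3} {v : Fin 3 → F} : v ∈ coordLine F c ↔ ∀ l, l ≠ c → v l = 0 :=
  Iff.rfl

/-- A vector of the coordinate line is `Pi.single c (v c)`. -/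
theorem eq_single_of_mem_coordLine {c : Fin 3} {v : Fin 3 → F} (hv : v ∈ coordLine F c) :
    v = Pi.single c (v c) := by
  funext l
  by_cases hl : l = c
  · subst hl; simp
  · rw [hv l hl, Pi.single_eq_of_ne hl]

theorem single_mem_coordLine (c : Fin 3) (a : F) : (Pi.single c a : Fin 3 → F) ∈ coordLine F c := by
  intro l hl
  simp [hl]

variable (F) [Fintype F] [DecidableEq F]

/-- The punctured coordinate line `{Pi.single c a : a ≠ 0}` as a `Finset`. -/
def puncLine (c : Fin 3) : Finset (Fin 3 → F) :=
  (univ.filter fun a : F => a ≠ 0).image fun a => Pi.single c a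

variable {F}

theorem mem_puncLine {c : Fin 3} {v : Fin 3 → F} :
    v ∈ puncLine F c ↔ v ∈ coordLine F c ∧ v ≠ 0 := by
  constructor
  · intro hv
    obtain ⟨a, ha, rfl⟩ := Finset.mem_image.1 hv
    have ha0 : a ≠ 0 := (Finset.mem_filter.1 ha).2
    refine ⟨single_mem_coordLine c a, ?_⟩
    intro h
    apply ha0
    have := congrFun h c
    simpa using this
  · rintro ⟨hv, hv0⟩
    refine Finset.mem_image.2 ⟨v c, ?_, (eq_single_of_mem_coordLine hv).symm⟩
    refine Finset.mem_filter.2 ⟨Finset.mem_univ _, ?_⟩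
    intro h0
    apply hv0
    rw [eq_single_of_mem_coordLine hv, h0, Pi.single_zero]

theorem mem_puncLine_iff_exists {c : Fin 3} {v : Fin 3 → F} :
    v ∈ puncLine F c ↔ ∃ a : F, a ≠ 0 ∧ v = Pi.single c a := by
  constructor
  · intro hv
    obtain ⟨a, ha, rfl⟩ := Finset.mem_image.1 hv
    exact ⟨a, (Finset.mem_filter.1 ha).2, rfl⟩
  · rintro ⟨a, ha, rfl⟩
    exact Finset.mem_image.2 ⟨a, Finset.mem_filter.2 ⟨Finset.mem_univ _, ha⟩, rfl⟩

theorem card_puncLine (c : Fin 3) : (puncLine F c).card = Fintype.card F - 1 := by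
  unfold puncLine
  have hinj : Function.Injective fun a : F => (Pi.single c a : Fin 3 → F) := fun a b h => by
    simpa using congrFun h c
  rw [Finset.card_image_of_injective _ hinj]
  rw [Finset.filter_ne' univ (0 : F), Finset.card_erase_of_mem (Finset.mem_univ _), Finset.card_univ]

/-- The CKSU design: block `i ∈ {0,1}` is `(e_i, e_{i+1}, e_{i+2})` (indices mod 3). -/
def rot (i : Fin 2) (r : Fin 3) : Fin 3 := ⟨(i.val + r.val) % 3, Nat.mod_lt _ (by norm_num)⟩

/-- `V W U` of the CKSU design. -/
def cksuV (i : Fin 2) : Submodule F (Fin 3 → F) := coordLine F (rot i 0)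
def cksuW (i : Fin 2) : Submodule F (Fin 3 → F) := coordLine F (rot i 1)
def cksuU (i : Fin 2) : Submodule F (Fin 3 → F) := coordLine F (rot i 2)
def cksuA (i : Fin 2) : Finset (Fin 3 → F) := puncLine F (rot i 0)
def cksuB (i : Fin 2) : Finset (Fin 3 → F) := puncLine F (rot i 1)
def cksuC (i : Fin 2) : Finset (Fin 3 → F) := puncLine F (rot i 2)

/-- The CKSU coordinate design is STPP over every field. -/
theorem cksu_isSTPP :
    Literature.Computability.AlgebraicComplexity.IsSTPP (cksuA (F := F)) cksuB cksuC := by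
  intro i j k s hs s' hs' t ht t' ht' u hu u' hu' h
  simp only [cksuA, cksuB, cksuC, mem_puncLine_iff_exists] at hs hs' ht ht' hu hu'
  obtain ⟨a, ha, rfl⟩ := hs
  obtain ⟨a', ha', rfl⟩ := hs'
  obtain ⟨b, hb, rfl⟩ := ht
  obtain ⟨b', hb', rfl⟩ := ht'
  obtain ⟨c, hc, rfl⟩ := hu
  obtain ⟨c', hc', rfl⟩ := hu'
  have h0 := congrFun h 0
  have h1 := congrFun h 1
  have h2 := congrFun h 2
  fin_cases i <;> fin_cases j <;> fin_cases k <;>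
    simp [rot] at h0 h1 h2 ⊢ <;>
    first
    | exact absurd h0 (by assumption)
    | exact absurd h1 (by assumption)
    | exact absurd h2 (by assumption)
    | (refine ⟨?_, ?_, ?_⟩ <;> first | (rw [sub_eq_zero] at h0; exact h0.symm) | (rw [sub_eq_zero] at h1; exact h1.symm) | (rw [sub_eq_zero] at h2; exact h2.symm))


end CKSU

/-! ## Tightness at `τ = 3`, the swapped-quantifier statement, and the junk at `τ = 0` -/

section Tightness

/-- The CKSU design gives `FrameWitnessN 3 τ F 2` as soon as `|F|^3 ≤ 2·((|F|-1)^3)^{τ/3}`. -/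
theorem cksu_frameWitnessN (F : Type) [Field F] [Fintype F] (τ : ℝ)
    (hτ : (Fintype.card F : ℝ) ^ 3 ≤
      2 * ((((Fintype.card F - 1) * (Fintype.card F - 1) * (Fintype.card F - 1) : ℕ) : ℝ)) ^ (τ / 3)) :
    FrameWitnessN 3 τ F 2 := by
  classical
  refine ⟨cksuV, cksuW, cksuU, cksuA, cksuB, cksuC, ?_, ?_, ?_, cksu_isSTPP, ?_⟩
  · intro i v; exact mem_puncLine
  · intro i v; exact mem_puncLine
  · intro i v; exact mem_puncLine
  · simp only [cksuA, cksuB, cksuC, card_puncLine]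
    rw [Finset.sum_const, Finset.card_univ, Fintype.card_fin]
    simpa [nsmul_eq_mul] using hτ

/-- `q^3 + 3 ≤ 2 (q-1)^3` for `q ≥ 5` (`2(q-1)^3 - q^3 - 3 = (q-5)(q^2-q+1)`). -/
theorem cube_le_two_mul (q : ℕ) (hq : 5 ≤ q) :
    (q : ℝ) ^ 3 + 3 ≤ 2 * ((((q - 1) * (q - 1) * (q - 1) : ℕ) : ℝ)) := by
  have h1 : (1 : ℕ) ≤ q := by omega
  have hq' : (5 : ℝ) ≤ q := by exact_mod_cast hq
  push_cast [Nat.cast_sub h1]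
  nlinarith [mul_nonneg (sub_nonneg.2 hq') (sq_nonneg ((q : ℝ) - 1)),
    mul_nonneg (sub_nonneg.2 hq') (by linarith : (0 : ℝ) ≤ q)]

theorem exists_prime_ge_five (q₀ : ℕ) : ∃ p : ℕ, p.Prime ∧ q₀ ≤ p ∧ 5 ≤ p := by
  obtain ⟨p, hp, hprime⟩ := Nat.exists_infinite_primes (max q₀ 5)
  exact ⟨p, hprime, le_of_max_le_left hp, le_of_max_le_right hp⟩

/-- RELAXATION R1 (`τ ≤ 3` in place of `τ < 3`). -/
def SubcubicFrameFamilyTauLe : Prop :=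
  ∃ (m : ℕ) (τ : ℝ), 2 ≤ τ ∧ τ ≤ 3 ∧ ∀ q₀ : ℕ, ∃ (F : Type) (_ : Field F) (_ : Fintype F),
    q₀ ≤ Fintype.card F ∧ FrameWitness m τ F

/-- **R1 is TRUE: the exponent 3 is attained in bounded rank** (`m = 3`, two blocks of punctured
coordinate lines, CKSU 2005 §5 / arXiv:math/0511460 Prop. 28, over `ZMod p`, `p ≥ 5`).  So the
whole content of the crux is the strict inequality `τ < 3`: `inf Spec(w_inf) ≤ 3` is free. -/
theorem subcubicFrameFamilyTauLe_holds : SubcubicFrameFamilyTauLe := by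
  refine ⟨3, 3, by norm_num, le_rfl, fun q₀ => ?_⟩
  obtain ⟨p, hprime, hpq, hp5⟩ := exists_prime_ge_five q₀
  haveI : Fact p.Prime := ⟨hprime⟩
  refine ⟨ZMod p, inferInstance, inferInstance, by rwa [ZMod.card], 2, cksu_frameWitnessN _ _ ?_⟩
  rw [ZMod.card, show ((3 : ℝ) / 3) = 1 by norm_num, Real.rpow_one]
  linarith [cube_le_two_mul p hp5]

/-- RELAXATION R2 (quantifiers swapped: the exponent may depend on the field size). -/
def SubcubicFrameFamilySwapped : Prop :=
  ∀ q₀ : ℕ, ∃ (m : ℕ) (τ : ℝ), 2 ≤ τ ∧ τ < 3 ∧ ∃ (F : Type) (_ : Field F) (_ : Fintype F),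
    q₀ ≤ Fintype.card F ∧ FrameWitness m τ F

/-- **R2 is TRUE: for every single field some `τ_q < 3` works** (same design; `τ_p → 3⁻` by
continuity of `τ ↦ 2((p-1)^3)^{τ/3}` at `τ = 3`, where the inequality is strict).  So the whole
content of the crux is UNIFORMITY of `τ` in `|F|`: any disproof must exploit `|F| → ∞` at fixed `τ`. -/
theorem subcubicFrameFamilySwapped_holds : SubcubicFrameFamilySwapped := by
  intro q₀
  obtain ⟨p, hprime, hpq, hp5⟩ := exists_prime_ge_five q₀
  haveI : Fact p.Prime := ⟨hprime⟩
  set x : ℝ := ((((p - 1) * (p - 1) * (p - 1) : ℕ) : ℝ)) with hx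
  have hx0 : 0 < x := by
    have h1 : 1 ≤ p := by omega
    have h5 : (5 : ℝ) ≤ p := by exact_mod_cast hp5
    have : (0 : ℝ) < (p : ℝ) - 1 := by linarith
    rw [hx]; push_cast [Nat.cast_sub h1]; positivity
  have h3 : (p : ℝ) ^ 3 < 2 * x ^ ((3 : ℝ) / 3) := by
    rw [show ((3 : ℝ) / 3) = 1 by norm_num, Real.rpow_one]
    linarith [cube_le_two_mul p hp5]
  have hcont : Continuous fun τ : ℝ => 2 * x ^ (τ / 3) :=
    continuous_const.mul (continuous_const.rpow (continuous_id.div_const 3) fun _ => Or.inl hx0.ne')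
  have hev : ∀ᶠ τ in 𝓝 (3 : ℝ), (p : ℝ) ^ 3 < 2 * x ^ (τ / 3) :=
    (hcont.tendsto 3).eventually_const_lt h3
  have hev2 : ∀ᶠ τ in 𝓝 (3 : ℝ), (2 : ℝ) < τ := eventually_gt_nhds (by norm_num)
  have hev3 : ∀ᶠ τ in 𝓝[<] (3 : ℝ), τ < 3 := eventually_nhdsWithin_of_forall fun τ hτ => hτ
  obtain ⟨τ, ⟨hτ1, hτ2⟩, hτ3⟩ :=
    (((hev.and hev2).filter_mono nhdsWithin_le_nhds).and hev3).exists
  refine ⟨3, τ, hτ2.le, hτ3, ZMod p, inferInstance, inferInstance, by rwa [ZMod.card], 2,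
    cksu_frameWitnessN _ _ ?_⟩
  rw [ZMod.card]
  exact hτ1.le

/-- RELAXATION R3 (`2 ≤ τ` dropped). -/
def SubcubicFrameFamilyDropTwoLe : Prop :=
  ∃ (m : ℕ) (τ : ℝ), τ < 3 ∧ ∀ q₀ : ℕ, ∃ (F : Type) (_ : Field F) (_ : Fintype F),
    q₀ ≤ Fintype.card F ∧ FrameWitness m τ F

/-- **R3 is TRUE BY JUNK**: `τ = 0`, `m = 0`, one block of EMPTY frames — `(0:ℝ)^(0/3) = 1 ≥ |F|^0`
(`Real.rpow 0 0 = 1`) and the empty family is vacuously STPP.  The hypothesis `2 ≤ τ` of the crux is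
load-bearing only against this junk (for `0 < τ < 2` the statement is equivalent to `τ = 2`). -/
theorem subcubicFrameFamilyDropTwoLe_holds : SubcubicFrameFamilyDropTwoLe := by
  refine ⟨0, 0, by norm_num, fun q₀ => ?_⟩
  obtain ⟨p, hprime, hpq, -⟩ := exists_prime_ge_five q₀
  haveI : Fact p.Prime := ⟨hprime⟩
  refine ⟨ZMod p, inferInstance, inferInstance, by rwa [ZMod.card], 1, fun _ => ⊥, fun _ => ⊥,
    fun _ => ⊥, fun _ => ∅, fun _ => ∅, fun _ => ∅, ?_, ?_, ?_, ?_, ?_⟩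
  · intro i v; simp [Subsingleton.elim v 0]
  · intro i v; simp [Subsingleton.elim v 0]
  · intro i v; simp [Subsingleton.elim v 0]
  · intro i j k s hs; simp at hs
  · simp

end Tightness

/-! ## Complementary frames: at most two blocks (pointwise engine) -/

section Engine

variable {F : Type} [Field F] [Fintype F] {M : Type} [AddCommGroup M] [Module F M]

/-- **Pointwise engine** (`|F| ≥ 5`): a subspace is not covered by four subspaces none of which
contains it (Mathlib: `Submodule.iUnion_ssubset_of_forall_ne_top_of_card_lt`). -/
theorem exists_mem_notMem_four (hF : 5 ≤ Fintype.card F) {R X₁ X₂ X₃ X₄ : Submodule F M}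
    (h₁ : ¬ R ≤ X₁) (h₂ : ¬ R ≤ X₂) (h₃ : ¬ R ≤ X₃) (h₄ : ¬ R ≤ X₄) :
    ∃ z ∈ R, z ∉ X₁ ∧ z ∉ X₂ ∧ z ∉ X₃ ∧ z ∉ X₄ := by
  let p : Fin 4 → Submodule F R := ![X₁.comap R.subtype, X₂.comap R.subtype,
    X₃.comap R.subtype, X₄.comap R.subtype]
  have hne : ∀ X : Submodule F M, ¬ R ≤ X → X.comap R.subtype ≠ ⊤ := by
    intro X hX htop
    apply hX
    intro z hz
    have : (⟨z, hz⟩ : R) ∈ X.comap R.subtype := by rw [htop]; exact Submodule.mem_top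
    simpa using this
  have hp : ∀ i, p i ≠ ⊤ := by
    intro i
    fin_cases i
    · exact hne X₁ h₁
    · exact hne X₂ h₂
    · exact hne X₃ h₃
    · exact hne X₄ h₄
  have hcard : ((Finset.univ : Finset (Fin 4)).card : ℕ∞) < ENat.card F := by
    rw [ENat.card_eq_coe_fintype_card, Finset.card_univ, Fintype.card_fin]
    exact_mod_cast (by omega : 4 < Fintype.card F)
  obtain ⟨z, -, hz⟩ := Set.exists_of_ssubset
    (Submodule.iUnion_ssubset_of_forall_ne_top_of_card_lt Finset.univ p hp hcard)
  simp only [Set.mem_iUnion, Finset.mem_univ, exists_true_left, not_exists, SetLike.mem_coe] at hz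
  refine ⟨z, z.2, ?_, ?_, ?_, ?_⟩
  · simpa [p] using hz 0
  · simpa [p] using hz 1
  · simpa [p] using hz 2
  · simpa [p] using hz 3

end Engine

section Direct

variable {F : Type} [Field F] {M : Type} [AddCommGroup M] [Module F M]

/-- Directness of a triple of subspaces: `x + y + z = 0` with `x ∈ X, y ∈ Y, z ∈ Z` forces all zero. -/
def Direct (X Y Z : Submodule F M) : Prop :=
  ∀ x ∈ X, ∀ y ∈ Y, ∀ z ∈ Z, x + y + z = 0 → x = 0 ∧ y = 0 ∧ z = 0

theorem Direct.rotate {X Y Z : Submodule F M} (h : Direct X Y Z) : Direct Y Z X := by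
  intro y hy z hz x hx hsum
  obtain ⟨h1, h2, h3⟩ := h x hx y hy z hz (by rw [← hsum]; abel)
  exact ⟨h2, h3, h1⟩

/-- `(X ⊔ Y) ⊓ (X ⊔ Z) = X` for a direct triple. -/
theorem Direct.sup_inf_sup {X Y Z : Submodule F M} (h : Direct X Y Z) : (X ⊔ Y) ⊓ (X ⊔ Z) = X := by
  refine le_antisymm ?_ (le_inf le_sup_left le_sup_left)
  intro w hw
  obtain ⟨hw1, hw2⟩ := Submodule.mem_inf.1 hw
  obtain ⟨x, hx, y, hy, rfl⟩ := Submodule.mem_sup.1 hw1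
  obtain ⟨x', hx', z, hz, hxz⟩ := Submodule.mem_sup.1 hw2
  have key : (x - x') + y + (-z) = 0 := by
    have : x + y - (x' + z) = 0 := by rw [hxz, sub_self]
    rw [← this]; abel
  obtain ⟨-, hy0, -⟩ := h _ (X.sub_mem hx hx') _ hy _ (Z.neg_mem hz) key
  rw [hy0, add_zero]; exact hx

/-- In a direct triple with `X ≠ 0`, `X` is not below `Y ⊔ Z`. -/
theorem Direct.not_le {X Y Z : Submodule F M} (h : Direct X Y Z) {x : M} (hx : x ∈ X) (hx0 : x ≠ 0) :
    ¬ X ≤ Y ⊔ Z := by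
  intro hle
  obtain ⟨y, hy, z, hz, hyz⟩ := Submodule.mem_sup.1 (hle hx)
  have key : x + (-y) + (-z) = 0 := by rw [← hyz]; abel
  exact hx0 (h _ hx _ (Y.neg_mem hy) _ (Z.neg_mem hz) key).1

end Direct


/-- Cyclic symmetry of the STPP clause: `(A, B, C) ↦ (B, C, A)` (read the relation with the
indices `(i, j, k) ↦ (k, i, j)`); copy of the tree's `IsSTPP.rotate` (Barriers file, not imported
by the route). [folklore] -/
theorem isSTPP_rotate {H : Type*} [AddCommGroup H] {N : ℕ} {A B C : Fin N → Finset H}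
    (h : IsSTPP A B C) : IsSTPP B C A := by
  intro i j k s hs s' hs' t ht t' ht' u hu u' hu' he
  have he' : (u' - u) + (s' - s) + (t' - t) = 0 := by rw [← he]; abel
  obtain ⟨h1, h2, h3, h4, h5⟩ := h k i j u hu u' hu' s hs s' hs' t ht t' ht' he'
  exact ⟨h2, (h1.trans h2).symm, h4, h5, h3⟩

section Complementary

variable {F : Type} [Field F] [Fintype F] {m N : ℕ}

/-- Over a field with at least three elements, every vector of `V` is a difference of two NON-ZERO
vectors of `V`, provided `A = V ∖ 0` is non-empty. -/
theorem exists_sub_eq_of_mem (hF : 3 ≤ Fintype.card F) {V : Submodule F (Fin m → F)}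
    {A : Finset (Fin m → F)} (hA : ∀ v, v ∈ A ↔ v ∈ V ∧ v ≠ 0) (hne : A.Nonempty)
    {v : Fin m → F} (hv : v ∈ V) : ∃ s ∈ A, ∃ s' ∈ A, s' - s = v := by
  by_cases hv0 : v = 0
  · obtain ⟨s, hs⟩ := hne
    exact ⟨s, hs, s, hs, by rw [hv0, sub_self]⟩
  · obtain ⟨c, hc0, hc1⟩ : ∃ c : F, c ≠ 0 ∧ c ≠ -1 := by
      classical
      have : (({0, -1} : Finset F)).card < (Finset.univ : Finset F).card := by
        calc ({0, -1} : Finset F).card ≤ 2 := Finset.card_le_two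
          _ < _ := by rw [Finset.card_univ]; omega
      obtain ⟨c, -, hc⟩ := Finset.exists_mem_notMem_of_card_lt_card this
      exact ⟨c, by simpa [not_or] using hc⟩
    refine ⟨c • v, (hA _).2 ⟨V.smul_mem c hv, smul_ne_zero hc0 hv0⟩, (c + 1) • v,
      (hA _).2 ⟨V.smul_mem _ hv, smul_ne_zero ?_ hv0⟩, ?_⟩
    · intro h; apply hc1; linear_combination h
    · rw [add_smul, one_smul]; abel

variable {V W U : Fin N → Submodule F (Fin m → F)} {A B C : Fin N → Finset (Fin m → F)}

/-- TPP ⇒ the frame of a full block is direct (`|F| ≥ 3`). -/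
theorem direct_of_full (hF : 3 ≤ Fintype.card F)
    (hA : ∀ i v, v ∈ A i ↔ v ∈ V i ∧ v ≠ 0) (hB : ∀ i v, v ∈ B i ↔ v ∈ W i ∧ v ≠ 0)
    (hC : ∀ i v, v ∈ C i ↔ v ∈ U i ∧ v ≠ 0) (hS : IsSTPP A B C) (i : Fin N)
    (hAi : (A i).Nonempty) (hBi : (B i).Nonempty) (hCi : (C i).Nonempty) :
    Direct (V i) (W i) (U i) := by
  intro v hv w hw u hu h0
  obtain ⟨s, hs, s', hs', hsv⟩ := exists_sub_eq_of_mem hF (hA i) hAi hv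
  obtain ⟨t, ht, t', ht', htw⟩ := exists_sub_eq_of_mem hF (hB i) hBi hw
  obtain ⟨u₁, hu₁, u', hu', huu⟩ := exists_sub_eq_of_mem hF (hC i) hCi hu
  have key : (s' - s) + (t' - t) + (u' - u₁) = 0 := by rw [hsv, htw, huu, h0]
  obtain ⟨-, -, h1, h2, h3⟩ := hS i i i s hs s' hs' t ht t' ht' u₁ hu₁ u' hu' key
  exact ⟨by rw [← hsv, h1, sub_self], by rw [← htw, h2, sub_self], by rw [← huu, h3, sub_self]⟩

/-- **Pair lemma (CLAIM 1).**  `|F| ≥ 5`; blocks `i ≠ k` full, block `i` complementary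
(`V_i ⊔ W_i ⊔ U_i = ⊤`).  Then `V_k ⊔ U_k ≤ V_i ⊔ W_i` or `V_k ⊔ U_k ≤ W_i ⊔ U_i`
(else a vector of `V_k ⊔ U_k` off `V_k, U_k, V_i ⊔ W_i, W_i ⊔ U_i` yields a violation of the
STPP clause `(i,i,k)`). -/
theorem sup_le_or_of_pair (hF : 5 ≤ Fintype.card F)
    (hA : ∀ i v, v ∈ A i ↔ v ∈ V i ∧ v ≠ 0) (hB : ∀ i v, v ∈ B i ↔ v ∈ W i ∧ v ≠ 0)
    (hC : ∀ i v, v ∈ C i ↔ v ∈ U i ∧ v ≠ 0) (hS : IsSTPP A B C) {i k : Fin N} (hik : i ≠ k)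
    (hBi : (B i).Nonempty) (hAk : (A k).Nonempty) (hCk : (C k).Nonempty)
    (hcomp : V i ⊔ W i ⊔ U i = ⊤) (hdk : Direct (V k) (W k) (U k)) :
    V k ⊔ U k ≤ V i ⊔ W i ∨ V k ⊔ U k ≤ W i ⊔ U i := by
  by_contra hcon
  rw [not_or] at hcon
  have hF3 : 3 ≤ Fintype.card F := by omega
  -- R_k is not inside V_k nor U_k
  have hRV : ¬ V k ⊔ U k ≤ V k := by
    obtain ⟨c, hc⟩ := hCk
    obtain ⟨hcU, hc0⟩ := (hC k c).1 hc
    intro hle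
    have hcV : c ∈ V k := hle (Submodule.mem_sup_right hcU)
    have key : c + 0 + (-c) = 0 := by abel
    exact hc0 (hdk c hcV 0 (W k).zero_mem (-c) ((U k).neg_mem hcU) key).1
  have hRU : ¬ V k ⊔ U k ≤ U k := by
    obtain ⟨a, ha⟩ := hAk
    obtain ⟨haV, ha0⟩ := (hA k a).1 ha
    intro hle
    have haU : a ∈ U k := hle (Submodule.mem_sup_left haV)
    have key : a + 0 + (-a) = 0 := by abel
    exact ha0 (hdk a haV 0 (W k).zero_mem (-a) ((U k).neg_mem haU) key).1
  obtain ⟨z, hzR, hz1, hz2, hz3, hz4⟩ := exists_mem_notMem_four hF hcon.1 hcon.2 hRV hRU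
  -- decompose z in block k and in block i
  obtain ⟨v', hv', u', hu', hvu⟩ := Submodule.mem_sup.1 hzR
  have hv'0 : v' ≠ 0 := by rintro rfl; apply hz4; rw [← hvu, zero_add]; exact hu'
  have hu'0 : u' ≠ 0 := by rintro rfl; apply hz3; rw [← hvu, add_zero]; exact hv'
  have hztop : z ∈ V i ⊔ W i ⊔ U i := by rw [hcomp]; exact Submodule.mem_top
  obtain ⟨vw, hvw, u, hu, hvwu⟩ := Submodule.mem_sup.1 hztop
  obtain ⟨v, hv, w, hw, rfl⟩ := Submodule.mem_sup.1 hvw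
  have hv0 : v ≠ 0 := by
    rintro rfl; apply hz2; rw [← hvwu, zero_add]
    exact Submodule.add_mem _ (Submodule.mem_sup_left hw) (Submodule.mem_sup_right hu)
  have hu0 : u ≠ 0 := by
    rintro rfl; apply hz1; rw [← hvwu, add_zero]
    exact Submodule.add_mem _ (Submodule.mem_sup_left hv) (Submodule.mem_sup_right hw)
  -- the violating sextuple for the clause (i,i,k)
  obtain ⟨t, ht, t', ht', htw⟩ := exists_sub_eq_of_mem hF3 (hB i) hBi hw
  have hs : v' ∈ A k := (hA k v').2 ⟨hv', hv'0⟩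
  have hs' : v ∈ A i := (hA i v).2 ⟨hv, hv0⟩
  have hu₀ : -u ∈ C i := (hC i _).2 ⟨(U i).neg_mem hu, neg_ne_zero.2 hu0⟩
  have hu₀' : -u' ∈ C k := (hC k _).2 ⟨(U k).neg_mem hu', neg_ne_zero.2 hu'0⟩
  have key : (v - v') + (t' - t) + (-u' - -u) = 0 := by
    rw [htw]
    have : v + w + u - (v' + u') = 0 := by rw [hvwu, hvu, sub_self]
    rw [← this]; abel
  obtain ⟨-, hik', -⟩ := hS i i k v' hs v hs' t ht t' ht' (-u) hu₀ (-u') hu₀' key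
  exact hik hik'

omit [Fintype F] in
/-- Lattice facts of a full complementary direct block: non-containments, tops, intersections. -/
theorem block_facts {Vx Wx Ux : Submodule F (Fin m → F)} (hd : Direct Vx Wx Ux)
    (hV : ∃ v ∈ Vx, v ≠ 0) (hW : ∃ w ∈ Wx, w ≠ 0) (hU : ∃ u ∈ Ux, u ≠ 0) (hcomp : Vx ⊔ Wx ⊔ Ux = ⊤) :
    (¬ Vx ≤ Wx ⊔ Ux) ∧ (¬ Wx ≤ Vx ⊔ Ux) ∧ (¬ Ux ≤ Vx ⊔ Wx) ∧
    ((⊤ : Submodule F (Fin m → F)) ≤ (Vx ⊔ Wx) ⊔ (Vx ⊔ Ux)) ∧ (⊤ ≤ (Vx ⊔ Wx) ⊔ (Wx ⊔ Ux)) ∧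
    (⊤ ≤ (Wx ⊔ Ux) ⊔ (Vx ⊔ Ux)) ∧
    ((Vx ⊔ Wx) ⊓ (Vx ⊔ Ux) = Vx) ∧ ((Vx ⊔ Wx) ⊓ (Wx ⊔ Ux) = Wx) ∧ ((Wx ⊔ Ux) ⊓ (Vx ⊔ Ux) = Ux) := by
  obtain ⟨v, hv, hv0⟩ := hV
  obtain ⟨w, hw, hw0⟩ := hW
  obtain ⟨u, hu, hu0⟩ := hU
  refine ⟨hd.not_le hv hv0, ?_, hd.rotate.rotate.not_le hu hu0, ?_, ?_, ?_, hd.sup_inf_sup, ?_, ?_⟩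
  · rw [sup_comm]; exact hd.rotate.not_le hw hw0
  · rw [← hcomp]; exact sup_le le_sup_left (le_sup_of_le_right le_sup_right)
  · rw [← hcomp]; exact sup_le le_sup_left (le_sup_of_le_right le_sup_right)
  · rw [← hcomp]; exact sup_le (sup_le (le_sup_of_le_right le_sup_left) (le_sup_of_le_left le_sup_left))
      (le_sup_of_le_left le_sup_right)
  · have := hd.rotate.sup_inf_sup; rwa [sup_comm Wx Vx, inf_comm] at this
  · have := hd.rotate.rotate.sup_inf_sup; rwa [sup_comm Ux Vx, sup_comm Ux Wx, inf_comm] at this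

/-- The rotation relation between blocks: block `y` is `(W_x, U_x, V_x)`. -/
def Rel (V W U : Fin N → Submodule F (Fin m → F)) (x y : Fin N) : Prop :=
  V y = W x ∧ W y = U x ∧ U y = V x

/-- **Two distinct complementary full blocks are cyclic rotations of each other** (`|F| ≥ 5`). -/
theorem rel_or_rel_of_pair (hF : 5 ≤ Fintype.card F)
    (hA : ∀ i v, v ∈ A i ↔ v ∈ V i ∧ v ≠ 0) (hB : ∀ i v, v ∈ B i ↔ v ∈ W i ∧ v ≠ 0)
    (hC : ∀ i v, v ∈ C i ↔ v ∈ U i ∧ v ≠ 0) (hS : IsSTPP A B C) {i k : Fin N} (hik : i ≠ k)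
    (hAi : (A i).Nonempty) (hBi : (B i).Nonempty) (hCi : (C i).Nonempty) (hci : V i ⊔ W i ⊔ U i = ⊤)
    (hAk : (A k).Nonempty) (hBk : (B k).Nonempty) (hCk : (C k).Nonempty) (hck : V k ⊔ W k ⊔ U k = ⊤) :
    Rel V W U i k ∨ Rel V W U k i := by
  have hF3 : 3 ≤ Fintype.card F := by omega
  have di := direct_of_full hF3 hA hB hC hS i hAi hBi hCi
  have dk := direct_of_full hF3 hA hB hC hS k hAk hBk hCk
  have nz : ∀ {X : Submodule F (Fin m → F)} {S : Finset (Fin m → F)},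
      (∀ v, v ∈ S ↔ v ∈ X ∧ v ≠ 0) → S.Nonempty → ∃ v ∈ X, v ≠ 0 :=
    fun hX ⟨v, hv⟩ => ⟨v, ((hX v).1 hv).1, ((hX v).1 hv).2⟩
  obtain ⟨nVi, nWi, nUi, tPRi, tPQi, tQRi, iVi, iWi, iUi⟩ :=
    block_facts di (nz (hA i) hAi) (nz (hB i) hBi) (nz (hC i) hCi) hci
  obtain ⟨nVk, nWk, nUk, tPRk, tPQk, tQRk, iVk, iWk, iUk⟩ :=
    block_facts dk (nz (hA k) hAk) (nz (hB k) hBk) (nz (hC k) hCk) hck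
  have hci' : W i ⊔ U i ⊔ V i = ⊤ := by rw [← hci]; ac_rfl
  have hci'' : U i ⊔ V i ⊔ W i = ⊤ := by rw [← hci]; ac_rfl
  have hck' : W k ⊔ U k ⊔ V k = ⊤ := by rw [← hck]; ac_rfl
  have hck'' : U k ⊔ V k ⊔ W k = ⊤ := by rw [← hck]; ac_rfl
  -- the six containment alternatives, canonical sides P = V ⊔ W, Q = W ⊔ U, R = V ⊔ U
  have c1 : V k ⊔ U k ≤ V i ⊔ W i ∨ V k ⊔ U k ≤ W i ⊔ U i :=
    sup_le_or_of_pair hF hA hB hC hS hik hBi hAk hCk hci dk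
  have c3 : V k ⊔ W k ≤ W i ⊔ U i ∨ V k ⊔ W k ≤ V i ⊔ U i := by
    have := sup_le_or_of_pair hF hB hC hA (isSTPP_rotate hS) hik hCi hBk hAk hci' dk.rotate
    rwa [sup_comm (W k) (V k), sup_comm (U i) (V i)] at this
  have c2 : W k ⊔ U k ≤ V i ⊔ U i ∨ W k ⊔ U k ≤ V i ⊔ W i := by
    have := sup_le_or_of_pair hF hC hA hB (isSTPP_rotate (isSTPP_rotate hS)) hik hAi hCk hBk hci'' dk.rotate.rotate
    rwa [sup_comm (U k) (W k), sup_comm (U i) (V i)] at this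
  have c1' : V i ⊔ U i ≤ V k ⊔ W k ∨ V i ⊔ U i ≤ W k ⊔ U k :=
    sup_le_or_of_pair hF hA hB hC hS hik.symm hBk hAi hCi hck di
  have c3' : V i ⊔ W i ≤ W k ⊔ U k ∨ V i ⊔ W i ≤ V k ⊔ U k := by
    have := sup_le_or_of_pair hF hB hC hA (isSTPP_rotate hS) hik.symm hCk hBi hAi hck' di.rotate
    rwa [sup_comm (W i) (V i), sup_comm (U k) (V k)] at this
  have c2' : W i ⊔ U i ≤ V k ⊔ U k ∨ W i ⊔ U i ≤ V k ⊔ W k := by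
    have := sup_le_or_of_pair hF hC hA hB (isSTPP_rotate (isSTPP_rotate hS)) hik.symm hAk hCi hBi hck'' di.rotate.rotate
    rwa [sup_comm (U i) (W i), sup_comm (U k) (V k)] at this
  -- handy: X ≤ ... from tops
  have vle : ∀ {X : Submodule F (Fin m → F)}, ⊤ ≤ X → ∀ Y : Submodule F (Fin m → F), Y ≤ X :=
    fun h Y => le_top.trans h
  rcases c3 with hPk | hPk
  · -- Case A: P_k ≤ Q_i
    have hRk : V k ⊔ U k ≤ V i ⊔ W i := c1.resolve_right fun h =>
      nVi (vle (tPRk.trans (sup_le hPk h)) _)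
    have hQk : W k ⊔ U k ≤ V i ⊔ U i := c2.resolve_right fun h =>
      nUi (vle (tQRk.trans (sup_le h hRk)) _)
    have e2 : W k ⊔ U k = V i ⊔ U i := le_antisymm hQk (c1'.resolve_left fun h =>
      nVi (le_sup_left.trans (h.trans hPk)))
    have e3 : V k ⊔ U k = V i ⊔ W i := le_antisymm hRk (c3'.resolve_left fun h =>
      nWi (le_sup_right.trans (h.trans hQk)))
    have e1 : V k ⊔ W k = W i ⊔ U i := le_antisymm hPk (c2'.resolve_left fun h =>
      nUi (le_sup_right.trans (h.trans hRk)))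
    left
    refine ⟨?_, ?_, ?_⟩
    · rw [← iVk, e1, e3, inf_comm, iWi]
    · rw [← iWk, e1, e2, iUi]
    · rw [← iUk, e2, e3, inf_comm, iVi]
  · -- Case B: P_k ≤ R_i
    have hRk : V k ⊔ U k ≤ W i ⊔ U i := c1.resolve_left fun h => by
      rcases c3' with h3 | h3
      · rcases c2 with h2 | h2
        · exact nWi (le_sup_right.trans (h3.trans h2))
        · exact nVk (le_sup_left.trans (h.trans (le_antisymm h3 h2 ▸ le_rfl)))
      · have e : V k ⊔ U k = V i ⊔ W i := le_antisymm h h3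
        rcases c2 with h2 | h2
        · exact nWi (vle (tPQk.trans (sup_le hPk h2)) _)
        · exact nWk (le_sup_left.trans (h2.trans (e ▸ le_rfl)))
    have hQk : W k ⊔ U k ≤ V i ⊔ W i := c2.resolve_left fun h =>
      nWi (vle (tPQk.trans (sup_le hPk h)) _)
    have e1 : V k ⊔ W k = V i ⊔ U i := le_antisymm hPk (c1'.resolve_right fun h =>
      nUi (le_sup_right.trans (h.trans hQk)))
    have e3 : V k ⊔ U k = W i ⊔ U i := le_antisymm hRk (c2'.resolve_right fun h =>
      nWi (le_sup_left.trans (h.trans hPk)))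
    have e2 : W k ⊔ U k = V i ⊔ W i := le_antisymm hQk (c3'.resolve_right fun h =>
      nVi (le_sup_left.trans (h.trans hRk)))
    right
    refine ⟨?_, ?_, ?_⟩
    · rw [← iWk, e1, e2, inf_comm, iVi]
    · rw [← iUk, e2, e3, iWi]
    · rw [← iVk, e1, e3, inf_comm, iUi]

omit [Fintype F] in
/-- Three blocks in a rotation chain `x → y → z` violate the STPP clause `(x, y, z)`. -/
theorem not_rel_rel (hA : ∀ i v, v ∈ A i ↔ v ∈ V i ∧ v ≠ 0) (hB : ∀ i v, v ∈ B i ↔ v ∈ W i ∧ v ≠ 0)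
    (hC : ∀ i v, v ∈ C i ↔ v ∈ U i ∧ v ≠ 0) (hS : IsSTPP A B C) {x y z : Fin N} (hxy : x ≠ y)
    (hAx : (A x).Nonempty) (hBx : (B x).Nonempty) (hCx : (C x).Nonempty)
    (h1 : Rel V W U x y) (h2 : Rel V W U y z) : False := by
  obtain ⟨a, ha⟩ := hAx
  obtain ⟨b, hb⟩ := hBx
  obtain ⟨c, hc⟩ := hCx
  obtain ⟨hVy, hWy, hUy⟩ := h1
  obtain ⟨hVz, -, hUz⟩ := h2
  -- clause (x, y, z): s ∈ A z, s' ∈ A x, t ∈ B x, t' ∈ B y, u ∈ C y, u' ∈ C z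
  have hs : c ∈ A z := by rw [hA, hVz, hWy]; exact (hC x c).1 hc
  have ht' : c ∈ B y := by rw [hB, hWy]; exact (hC x c).1 hc
  have hu : a ∈ C y := by rw [hC, hUy]; exact (hA x a).1 ha
  have hu' : b ∈ C z := by rw [hC, hUz, hVy]; exact (hB x b).1 hb
  have key : (a - c) + (c - b) + (b - a) = 0 := by abel
  exact hxy (hS x y z c hs a ha b hb c ht' a hu b hu' key).1

/-- **ComplementaryAtMostTwo.** Over a finite field with `|F| ≥ 5`, an STPP family of
punctured-subspace frames in `F^m` has at most two full blocks whose frame spans `F^m`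
(`V_i ⊔ W_i ⊔ U_i = ⊤`).  Paper proof: two such blocks are cyclic rotations of each other
(`rel_or_rel_of_pair`, pointwise engine = a space over `F` is not a union of 4 proper subspaces),
and every tournament on three blocks contains a rotation chain `x → y → z`, which violates the
all-distinct STPP clause (`not_rel_rel`).  Kills every numerology with `v = m` (e ≥ 1) for the
crux and generalises `RankThreeNoGo`. -/
theorem complementary_atMostTwo (hF : 5 ≤ Fintype.card F)
    (hA : ∀ i v, v ∈ A i ↔ v ∈ V i ∧ v ≠ 0) (hB : ∀ i v, v ∈ B i ↔ v ∈ W i ∧ v ≠ 0)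
    (hC : ∀ i v, v ∈ C i ↔ v ∈ U i ∧ v ≠ 0) (hS : IsSTPP A B C) :
    (Finset.univ.filter fun i => (A i).Nonempty ∧ (B i).Nonempty ∧ (C i).Nonempty ∧
      V i ⊔ W i ⊔ U i = ⊤).card ≤ 2 := by
  by_contra hlt
  rw [not_le, Finset.two_lt_card_iff] at hlt
  obtain ⟨i, k, l, hi, hk, hl, hik, hil, hkl⟩ := hlt
  simp only [Finset.mem_filter, Finset.mem_univ, true_and] at hi hk hl
  have rik := rel_or_rel_of_pair hF hA hB hC hS hik hi.1 hi.2.1 hi.2.2.1 hi.2.2.2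
    hk.1 hk.2.1 hk.2.2.1 hk.2.2.2
  have ril := rel_or_rel_of_pair hF hA hB hC hS hil hi.1 hi.2.1 hi.2.2.1 hi.2.2.2
    hl.1 hl.2.1 hl.2.2.1 hl.2.2.2
  have rkl := rel_or_rel_of_pair hF hA hB hC hS hkl hk.1 hk.2.1 hk.2.2.1 hk.2.2.2
    hl.1 hl.2.1 hl.2.2.1 hl.2.2.2
  have T := fun {x y z : Fin N} (hxy : x ≠ y) (hx : (A x).Nonempty ∧ (B x).Nonempty ∧ (C x).Nonempty ∧
      V x ⊔ W x ⊔ U x = ⊤) (h1 : Rel V W U x y) (h2 : Rel V W U y z) =>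
    not_rel_rel hA hB hC hS hxy hx.1 hx.2.1 hx.2.2.1 h1 h2
  rcases rik with rik | rki <;> rcases ril with ril | rli <;> rcases rkl with rkl | rlk
  · exact T hik hi rik rkl
  · exact T hil hi ril rlk
  · exact T hik hi rik rkl
  · exact T hil.symm hl rli rik
  · exact T hik.symm hk rki ril
  · exact T hik.symm hk rki ril
  · exact T hkl hk rkl rli
  · exact T hkl.symm hl rlk rki

end Complementary

/-! ## Rank restrictions: no full block in rank ≤ 2; rank 3 dies with `RankThreeNoGo` -/

section Rank

variable {F : Type} [Field F] [Fintype F]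

variable {m N : ℕ} {V W U : Fin N → Submodule F (Fin m → F)} {A B C : Fin N → Finset (Fin m → F)}

/-- **A full frame block needs rank ≥ 3** (`|F| ≥ 3`): nonzero `a ∈ A_i, b ∈ B_i, c ∈ C_i` are
linearly independent. -/
theorem three_le_rank_of_full (hF : 3 ≤ Fintype.card F)
    (hA : ∀ i v, v ∈ A i ↔ v ∈ V i ∧ v ≠ 0) (hB : ∀ i v, v ∈ B i ↔ v ∈ W i ∧ v ≠ 0)
    (hC : ∀ i v, v ∈ C i ↔ v ∈ U i ∧ v ≠ 0) (hS : IsSTPP A B C) (i : Fin N)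
    (hAi : (A i).Nonempty) (hBi : (B i).Nonempty) (hCi : (C i).Nonempty) : 3 ≤ m := by
  obtain ⟨a, ha⟩ := hAi
  obtain ⟨b, hb⟩ := hBi
  obtain ⟨c, hc⟩ := hCi
  have ha' := (hA i a).1 ha
  have hb' := (hB i b).1 hb
  have hc' := (hC i c).1 hc
  have hli : LinearIndependent F ![a, b, c] := by
    rw [Fintype.linearIndependent_iff]
    intro g hg j
    have hsum : g 0 • a + g 1 • b + g 2 • c = 0 := by
      simpa [Fin.sum_univ_three] using hg
    obtain ⟨h0, h1, h2⟩ := direct_of_full hF hA hB hC hS i ⟨a, ha⟩ ⟨b, hb⟩ ⟨c, hc⟩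
      _ ((V i).smul_mem _ ha'.1) _ ((W i).smul_mem _ hb'.1) _ ((U i).smul_mem _ hc'.1) hsum
    fin_cases j
    · exact (smul_eq_zero.1 h0).resolve_right ha'.2
    · exact (smul_eq_zero.1 h1).resolve_right hb'.2
    · exact (smul_eq_zero.1 h2).resolve_right hc'.2
  have := hli.fintype_card_le_finrank
  simpa using this

/-- No witness in rank `m ≤ 2` (`|F| ≥ 3`, `τ > 0`). -/
theorem not_frameWitnessN_rank_le_two (hm : m ≤ 2) (hF : 3 ≤ Fintype.card F) {τ : ℝ} (hτ : 0 < τ) :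
    ¬ FrameWitnessN m τ F N := by
  rintro ⟨V, W, U, A, B, C, hA, hB, hC, hS, hsum⟩
  have h1 := card_rpow_le_fullCount hτ hS hsum
  have hpos : (0 : ℝ) < fullCount A B C :=
    lt_of_lt_of_le (Real.rpow_pos_of_pos (Nat.cast_pos.2 Fintype.card_pos) _) h1
  have hpos' : 0 < fullCount A B C := by exact_mod_cast hpos
  obtain ⟨i, hi⟩ := Finset.card_pos.1 hpos'
  simp only [Finset.mem_filter, Finset.mem_univ, true_and] at hi
  have := three_le_rank_of_full hF hA hB hC hS i hi.1 hi.2.1 hi.2.2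
  omega

/-- In rank 3, `RankThreeNoGo` (route support item, ≤ 2 full blocks for `|F| ≥ 5`) leaves at most
`2·|F|^{τ}` for the power sum, `< |F|^3` once `|F|^{3-τ} > 2`. -/
theorem rankThreeNoGo_imp_not_frameWitnessN {τ : ℝ} (hτ0 : 0 < τ) (h : RankThreeNoGo)
    (hF5 : 5 ≤ Fintype.card F) (hbig : 2 < (Fintype.card F : ℝ) ^ ((3 : ℝ) * (1 - τ / 3))) {N : ℕ} :
    ¬ FrameWitnessN 3 τ F N := by
  rintro ⟨V, W, U, A, B, C, hA, hB, hC, hS, hsum⟩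
  have h1 := card_rpow_le_fullCount hτ0 hS hsum
  have h2 : fullCount A B C ≤ 2 := h F hF5 N V W U A B C hA hB hC hS
  have h2' : (fullCount A B C : ℝ) ≤ 2 := by exact_mod_cast h2
  push_cast at h1
  linarith

/-- STRENGTHENING S2 (rank at most 3). -/
def SubcubicFrameFamilyRankLe3 : Prop :=
  ∃ (m : ℕ) (τ : ℝ), m ≤ 3 ∧ 2 ≤ τ ∧ τ < 3 ∧ ∀ q₀ : ℕ, ∃ (F : Type) (_ : Field F) (_ : Fintype F),
    q₀ ≤ Fintype.card F ∧ FrameWitness m τ F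

/-- **¬ S2 given RankThreeNoGo: any witness of the crux has rank `m ≥ 4`.** -/
theorem rankThreeNoGo_imp_not_rankLe3 (h3 : RankThreeNoGo) : ¬ SubcubicFrameFamilyRankLe3 := by
  rintro ⟨m, τ, hm, h2, hτ, h⟩
  have he : 0 < (3 : ℝ) * (1 - τ / 3) := by linarith
  have htend : Tendsto (fun q : ℕ => (q : ℝ) ^ ((3 : ℝ) * (1 - τ / 3))) atTop atTop :=
    (tendsto_rpow_atTop he).comp tendsto_natCast_atTop_atTop
  obtain ⟨q₁, hq₁⟩ := Filter.eventually_atTop.1 (htend.eventually_gt_atTop (2 : ℝ))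
  obtain ⟨F, _, _, hF, N, hW⟩ := h (max q₁ 5)
  have hF5 : 5 ≤ Fintype.card F := le_of_max_le_right hF
  have hF1 : q₁ ≤ Fintype.card F := le_of_max_le_left hF
  rcases Nat.lt_or_ge m 3 with hm3 | hm3
  · exact not_frameWitnessN_rank_le_two (by omega) (by omega) (by linarith) hW
  · obtain rfl : m = 3 := le_antisymm hm hm3
    refine rankThreeNoGo_imp_not_frameWitnessN (by linarith) h3 hF5 ?_ hW
    calc (2 : ℝ) < (q₁ : ℝ) ^ ((3 : ℝ) * (1 - τ / 3)) := hq₁ q₁ le_rfl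
      _ ≤ _ := Real.rpow_le_rpow (Nat.cast_nonneg _) (by exact_mod_cast hF1) he.le

end Rank

/-! ## Dimension bookkeeping: where the blocks of a witness must live -/

section Bookkeeping

variable {F : Type} [Field F] [Fintype F]
variable {m N : ℕ} {V W U : Fin N → Submodule F (Fin m → F)} {A B C : Fin N → Finset (Fin m → F)}

/-- **Dimension bookkeeping**: a block's volume is at most `|F|^{dim (V_i ⊔ W_i ⊔ U_i)}`
(abelian TPP injectivity of `(a,b,c) ↦ a+b+c` into the span). -/
theorem card_block_le_pow_finrank
    (hA : ∀ i v, v ∈ A i ↔ v ∈ V i ∧ v ≠ 0) (hB : ∀ i v, v ∈ B i ↔ v ∈ W i ∧ v ≠ 0)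
    (hC : ∀ i v, v ∈ C i ↔ v ∈ U i ∧ v ≠ 0) (hS : IsSTPP A B C) (i : Fin N) :
    (A i).card * (B i).card * (C i).card ≤
      Fintype.card F ^ Module.finrank F ↥(V i ⊔ W i ⊔ U i) := by
  classical
  set S : Submodule F (Fin m → F) := V i ⊔ W i ⊔ U i with hSdef
  have hinj : Set.InjOn (fun p : (Fin m → F) × (Fin m → F) × (Fin m → F) => p.1 + p.2.1 + p.2.2)
      ↑(A i ×ˢ (B i ×ˢ C i)) := by
    rintro ⟨a, b, c⟩ habc ⟨a', b', c'⟩ habc' heq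
    simp only [Finset.coe_product, Set.mem_prod, Finset.mem_coe] at habc habc'
    obtain ⟨ha, hb, hc⟩ := habc
    obtain ⟨ha', hb', hc'⟩ := habc'
    have heq' : a + b + c = a' + b' + c' := heq
    have key : (a - a') + (b - b') + (c - c') = 0 := by
      have : (a - a') + (b - b') + (c - c') = (a + b + c) - (a' + b' + c') := by abel
      rw [this, heq', sub_self]
    obtain ⟨-, -, h1, h2, h3⟩ := hS i i i a' ha' a ha b' hb' b hb c' hc' c hc key
    rw [h1, h2, h3]
  have hmaps : Set.MapsTo (fun p : (Fin m → F) × (Fin m → F) × (Fin m → F) => p.1 + p.2.1 + p.2.2)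
      ↑(A i ×ˢ (B i ×ˢ C i)) ↑(Finset.univ.filter fun v => v ∈ S) := by
    rintro ⟨a, b, c⟩ habc
    simp only [Finset.coe_product, Set.mem_prod, Finset.mem_coe] at habc
    obtain ⟨ha, hb, hc⟩ := habc
    simp only [Finset.coe_filter, Finset.mem_univ, true_and, Set.mem_setOf_eq]
    exact S.add_mem (S.add_mem (Submodule.mem_sup_left (Submodule.mem_sup_left ((hA i a).1 ha).1))
      (Submodule.mem_sup_left (Submodule.mem_sup_right ((hB i b).1 hb).1)))
      (Submodule.mem_sup_right ((hC i c).1 hc).1)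
  have h1 := Finset.card_le_card_of_injOn _ hmaps hinj
  have h2 : (Finset.univ.filter fun v => v ∈ S).card = Fintype.card ↥S := (Fintype.card_subtype _).symm
  have h3 : Fintype.card ↥S = Fintype.card F ^ Module.finrank F ↥S := Module.card_eq_pow_finrank
  have h4 : (A i ×ˢ (B i ×ˢ C i)).card = (A i).card * (B i).card * (C i).card := by
    rw [Finset.card_product, Finset.card_product, mul_assoc]
  rw [← h4, ← h3, ← h2]
  exact h1

omit [Fintype F] in
/-- A non-complementary frame spans at most a hyperplane. -/
theorem finrank_lt_of_ne_top {S : Submodule F (Fin m → F)} (h : S ≠ ⊤) : Module.finrank F ↥S < m := by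
  simpa using Submodule.finrank_lt h

/-- **Witness bookkeeping** (`|F| ≥ 5`, `τ > 0`): the power sum of an STPP frame family is at most
`2·|F|^{mτ/3}` (the ≤ 2 complementary blocks) plus `N'·|F|^{(m−1)τ/3}`, `N'` = number of full
NON-complementary blocks.  So a witness of the crux needs
`N' ≥ (|F|^m − 2|F|^{mτ/3}) / |F|^{(m−1)τ/3} ≈ |F|^{m − (m−1)τ/3}` blocks on frames of dimension
sum `v ≤ m − 1` — e.g. for `m = 4`: `N' ≳ |F|^{4−τ} ≫ |F|` punctured-LINE blocks (census: 3). -/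
theorem sum_rpow_le_bookkeeping (hF : 5 ≤ Fintype.card F) {τ : ℝ} (hτ : 0 < τ)
    (hA : ∀ i v, v ∈ A i ↔ v ∈ V i ∧ v ≠ 0) (hB : ∀ i v, v ∈ B i ↔ v ∈ W i ∧ v ≠ 0)
    (hC : ∀ i v, v ∈ C i ↔ v ∈ U i ∧ v ≠ 0) (hS : IsSTPP A B C) :
    ∑ i, (((A i).card * (B i).card * (C i).card : ℕ) : ℝ) ^ (τ / 3) ≤
      2 * ((Fintype.card F : ℝ) ^ m) ^ (τ / 3) +
        (Finset.univ.filter fun i => ((A i).Nonempty ∧ (B i).Nonempty ∧ (C i).Nonempty) ∧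
            V i ⊔ W i ⊔ U i ≠ ⊤).card * ((Fintype.card F : ℝ) ^ (m - 1)) ^ (τ / 3) := by
  classical
  set X : ℝ := ((Fintype.card F : ℝ) ^ m) ^ (τ / 3)
  set Y : ℝ := ((Fintype.card F : ℝ) ^ (m - 1)) ^ (τ / 3)
  have hq1 : (1 : ℝ) ≤ Fintype.card F := by exact_mod_cast (show 1 ≤ Fintype.card F by omega)
  have hvol : ∀ i, (((A i).card * (B i).card * (C i).card : ℕ) : ℝ) ≤
      (Fintype.card F : ℝ) ^ Module.finrank F ↥(V i ⊔ W i ⊔ U i) := fun i => by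
    exact_mod_cast card_block_le_pow_finrank hA hB hC hS i
  have hterm : ∀ i, (((A i).card * (B i).card * (C i).card : ℕ) : ℝ) ^ (τ / 3) ≤
      (if ((A i).Nonempty ∧ (B i).Nonempty ∧ (C i).Nonempty) ∧ V i ⊔ W i ⊔ U i = ⊤ then X else 0) +
      (if ((A i).Nonempty ∧ (B i).Nonempty ∧ (C i).Nonempty) ∧ V i ⊔ W i ⊔ U i ≠ ⊤ then Y else 0) := by
    intro i
    by_cases hfull : (A i).Nonempty ∧ (B i).Nonempty ∧ (C i).Nonempty
    · by_cases htop : V i ⊔ W i ⊔ U i = ⊤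
      · rw [if_pos ⟨hfull, htop⟩, if_neg (fun h => h.2 htop), add_zero]
        refine Real.rpow_le_rpow (Nat.cast_nonneg _) ((hvol i).trans ?_) (by positivity)
        have : Module.finrank F ↥(V i ⊔ W i ⊔ U i) ≤ m := by
          simpa using Submodule.finrank_le (V i ⊔ W i ⊔ U i)
        exact pow_le_pow_right₀ hq1 this
      · rw [if_neg (fun h => htop h.2), if_pos ⟨hfull, htop⟩, zero_add]
        refine Real.rpow_le_rpow (Nat.cast_nonneg _) ((hvol i).trans ?_) (by positivity)
        have : Module.finrank F ↥(V i ⊔ W i ⊔ U i) ≤ m - 1 := by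
          have := finrank_lt_of_ne_top htop; omega
        exact pow_le_pow_right₀ hq1 this
    · rw [if_neg (fun h => hfull h.1), if_neg (fun h => hfull h.1), add_zero]
      have h0 : (A i).card * (B i).card * (C i).card = 0 := by
        simp only [not_and_or, Finset.not_nonempty_iff_eq_empty] at hfull
        rcases hfull with h | h | h <;> simp [h]
      rw [h0, Nat.cast_zero, Real.zero_rpow (by positivity)]
  refine (Finset.sum_le_sum fun i _ => hterm i).trans ?_
  rw [Finset.sum_add_distrib, Finset.sum_ite, Finset.sum_const_zero, add_zero, Finset.sum_const,
    nsmul_eq_mul, Finset.sum_ite, Finset.sum_const_zero, add_zero, Finset.sum_const, nsmul_eq_mul]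
  have hcomp := complementary_atMostTwo hF hA hB hC hS
  have hX : 0 ≤ X := by positivity
  have hc2 : ((Finset.univ.filter fun i => ((A i).Nonempty ∧ (B i).Nonempty ∧ (C i).Nonempty) ∧
      V i ⊔ W i ⊔ U i = ⊤).card : ℝ) ≤ 2 := by
    have : (Finset.univ.filter fun i => ((A i).Nonempty ∧ (B i).Nonempty ∧ (C i).Nonempty) ∧
        V i ⊔ W i ⊔ U i = ⊤) = (Finset.univ.filter fun i => (A i).Nonempty ∧ (B i).Nonempty ∧
        (C i).Nonempty ∧ V i ⊔ W i ⊔ U i = ⊤) := Finset.filter_congr fun i _ => by tauto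
    rw [this]; exact_mod_cast hcomp
  nlinarith [hc2, hX]

end Bookkeeping

/-! ## `RankThreeNoGo` (route support item 7625) follows; unconditional consequences -/

section Consequences

variable {F : Type} [Field F] [Fintype F]
variable {m N : ℕ} {V W U : Fin N → Submodule F (Fin m → F)} {A B C : Fin N → Finset (Fin m → F)}

/-- Nonzero `a ∈ A_i, b ∈ B_i, c ∈ C_i` of a full block are linearly independent (`|F| ≥ 3`). -/
theorem linearIndependent_of_full (hF : 3 ≤ Fintype.card F)
    (hA : ∀ i v, v ∈ A i ↔ v ∈ V i ∧ v ≠ 0) (hB : ∀ i v, v ∈ B i ↔ v ∈ W i ∧ v ≠ 0)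
    (hC : ∀ i v, v ∈ C i ↔ v ∈ U i ∧ v ≠ 0) (hS : IsSTPP A B C) (i : Fin N)
    {a b c : Fin m → F} (ha : a ∈ A i) (hb : b ∈ B i) (hc : c ∈ C i) :
    LinearIndependent F ![a, b, c] := by
  have ha' := (hA i a).1 ha
  have hb' := (hB i b).1 hb
  have hc' := (hC i c).1 hc
  rw [Fintype.linearIndependent_iff]
  intro g hg j
  have hsum : g 0 • a + g 1 • b + g 2 • c = 0 := by
    simpa [Fin.sum_univ_three] using hg
  obtain ⟨h0, h1, h2⟩ := direct_of_full hF hA hB hC hS i ⟨a, ha⟩ ⟨b, hb⟩ ⟨c, hc⟩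
    _ ((V i).smul_mem _ ha'.1) _ ((W i).smul_mem _ hb'.1) _ ((U i).smul_mem _ hc'.1) hsum
  fin_cases j
  · exact (smul_eq_zero.1 h0).resolve_right ha'.2
  · exact (smul_eq_zero.1 h1).resolve_right hb'.2
  · exact (smul_eq_zero.1 h2).resolve_right hc'.2

/-- In rank 3 every full block is complementary (`|F| ≥ 3`). -/
theorem sup_eq_top_of_full_rank_three (hF : 3 ≤ Fintype.card F)
    {V W U : Fin N → Submodule F (Fin 3 → F)} {A B C : Fin N → Finset (Fin 3 → F)}
    (hA : ∀ i v, v ∈ A i ↔ v ∈ V i ∧ v ≠ 0) (hB : ∀ i v, v ∈ B i ↔ v ∈ W i ∧ v ≠ 0)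
    (hC : ∀ i v, v ∈ C i ↔ v ∈ U i ∧ v ≠ 0) (hS : IsSTPP A B C) (i : Fin N)
    (hAi : (A i).Nonempty) (hBi : (B i).Nonempty) (hCi : (C i).Nonempty) :
    V i ⊔ W i ⊔ U i = ⊤ := by
  obtain ⟨a, ha⟩ := hAi
  obtain ⟨b, hb⟩ := hBi
  obtain ⟨c, hc⟩ := hCi
  have hli := linearIndependent_of_full hF hA hB hC hS i ha hb hc
  have hspan : Submodule.span F (Set.range ![a, b, c]) = ⊤ :=
    hli.span_eq_top_of_card_eq_finrank (by simp)
  rw [eq_top_iff, ← hspan, Submodule.span_le, Set.range_subset_iff]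
  intro j
  fin_cases j
  · simpa using (Submodule.mem_sup_left (Submodule.mem_sup_left ((hA i a).1 ha).1) :
      a ∈ V i ⊔ W i ⊔ U i)
  · simpa using (Submodule.mem_sup_left (Submodule.mem_sup_right ((hB i b).1 hb).1) :
      b ∈ V i ⊔ W i ⊔ U i)
  · simpa using (Submodule.mem_sup_right ((hC i c).1 hc).1 : c ∈ V i ⊔ W i ⊔ U i)

/-- **`RankThreeNoGo` holds** (route support item stmt-MatrixMultiplication-7625, as a corollary of
`complementary_atMostTwo`): over a finite field with `|F| ≥ 5`, an STPP family of punctured-subspace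
frames in `F^3` has at most two full blocks.  (Positive item: attached as candidate proof, a prover
lands it.) -/
theorem rankThreeNoGo_holds : RankThreeNoGo := by
  intro F _ _ hF N V W U A B C hA hB hC hS
  have hF3 : 3 ≤ Fintype.card F := by omega
  refine le_trans (Finset.card_le_card ?_) (complementary_atMostTwo hF hA hB hC hS)
  intro i hi
  simp only [Finset.mem_filter, Finset.mem_univ, true_and] at hi ⊢
  exact ⟨hi.1, hi.2.1, hi.2.2, sup_eq_top_of_full_rank_three hF3 hA hB hC hS i hi.1 hi.2.1 hi.2.2⟩

/-- **¬ S2, unconditionally: every witness of the crux has rank `m ≥ 4`.** -/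
theorem not_subcubicFrameFamilyRankLe3 : ¬ SubcubicFrameFamilyRankLe3 :=
  rankThreeNoGo_imp_not_rankLe3 rankThreeNoGo_holds

/-- STRENGTHENING S3 (complementary frames): the crux witnessed by families all of whose full
blocks span `F^m` (`v = d_A + d_B + d_C = m`, the route's "e ≥ 1, v = m" numerologies
`(4,(2,1,1))`, `(5,(2,2,1))`, `(6,(2,2,2))`, …). -/
def SubcubicFrameFamilyComplementary : Prop :=
  ∃ (m : ℕ) (τ : ℝ), 2 ≤ τ ∧ τ < 3 ∧ ∀ q₀ : ℕ, ∃ (F : Type) (_ : Field F) (_ : Fintype F),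
    q₀ ≤ Fintype.card F ∧ ∃ (N : ℕ) (V W U : Fin N → Submodule F (Fin m → F))
      (A B C : Fin N → Finset (Fin m → F)),
      (∀ i v, v ∈ A i ↔ v ∈ V i ∧ v ≠ 0) ∧ (∀ i v, v ∈ B i ↔ v ∈ W i ∧ v ≠ 0) ∧
      (∀ i v, v ∈ C i ↔ v ∈ U i ∧ v ≠ 0) ∧ IsSTPP A B C ∧
      (∀ i, (A i).Nonempty → (B i).Nonempty → (C i).Nonempty → V i ⊔ W i ⊔ U i = ⊤) ∧
      (Fintype.card F : ℝ) ^ m ≤ ∑ i, (((A i).card * (B i).card * (C i).card : ℕ) : ℝ) ^ (τ / 3)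

/-- **¬ S3: complementary frames never witness the crux** — at most two full blocks
(`complementary_atMostTwo`), each of power `≤ |F|^{mτ/3}`, against `|F|^m`. So a witness lives on
frames with `v ≤ m − 1` and must have `N_v ≥ |F|^{m − vτ/3}` of them for some `v`, i.e. beat the
count `|F|^{m−v}` by the power `|F|^{v(1−τ/3)}` (packing, BCCGNSU Lemma 2.4, allows `|F|^{m−2v/3}`). -/
theorem not_subcubicFrameFamilyComplementary : ¬ SubcubicFrameFamilyComplementary := by
  rintro ⟨m, τ, h2, h3, h⟩
  rcases Nat.eq_zero_or_pos m with hm | hm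
  · subst hm
    obtain ⟨F, _, _, -, N, V, W, U, A, B, C, hA, hB, hC, hS, -, hsum⟩ := h 0
    exact not_frameWitnessN_rank_zero (τ := τ) (by linarith) ⟨V, W, U, A, B, C, hA, hB, hC, hS, hsum⟩
  have he : 0 < (m : ℝ) * (1 - τ / 3) := mul_pos (by exact_mod_cast hm) (by linarith)
  have htend : Tendsto (fun q : ℕ => (q : ℝ) ^ ((m : ℝ) * (1 - τ / 3))) atTop atTop :=
    (tendsto_rpow_atTop he).comp tendsto_natCast_atTop_atTop
  obtain ⟨q₁, hq₁⟩ := Filter.eventually_atTop.1 (htend.eventually_gt_atTop (2 : ℝ))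
  obtain ⟨F, _, _, hF, N, V, W, U, A, B, C, hA, hB, hC, hS, hcomp, hsum⟩ := h (max q₁ 5)
  have hF5 : 5 ≤ Fintype.card F := le_of_max_le_right hF
  have hF1 : q₁ ≤ Fintype.card F := le_of_max_le_left hF
  have h1 := card_rpow_le_fullCount (by linarith) hS hsum
  have h4 : fullCount A B C ≤ 2 := by
    refine le_trans (Finset.card_le_card ?_) (complementary_atMostTwo hF5 hA hB hC hS)
    intro i hi
    simp only [Finset.mem_filter, Finset.mem_univ, true_and] at hi ⊢
    exact ⟨hi.1, hi.2.1, hi.2.2, hcomp i hi.1 hi.2.1 hi.2.2⟩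
  have h4' : (fullCount A B C : ℝ) ≤ 2 := by exact_mod_cast h4
  have h5 : (2 : ℝ) < (q₁ : ℝ) ^ ((m : ℝ) * (1 - τ / 3)) := hq₁ q₁ le_rfl
  have h6 : (q₁ : ℝ) ^ ((m : ℝ) * (1 - τ / 3)) ≤ (Fintype.card F : ℝ) ^ ((m : ℝ) * (1 - τ / 3)) :=
    Real.rpow_le_rpow (Nat.cast_nonneg _) (by exact_mod_cast hF1) he.le
  linarith

end Consequences


end Summit.MatrixMultiplication.MatrixMultiplication.Cruxes.SubcubicFrameFamily.Disproof
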